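import Mathlib
import Summits.PneNP.PneNP.Theorems.PstarOverlapCount

/-!
# Random typed `P⋆` instances: few outputs sit at high-degree variables (T24.9′ supply, the degree count)

FRONTIER range-avoidance ladder (cell `pnp-ideate`, ROUND-24 item T24.9′ for the gap-lemma supply `PstarGapLemma.ExpandingTypedBoundedDegSOExist`;
restricted-model combinatorics — nothing here bears on `P` versus `NP`).

In the R21 model `PstarExpandingModel.Outcome N m` the `x`-degree of a variable `u` (outputs whose XOR pair contains `u`) is a sum of `m`
independent indicators of probability `2/N`; a vertex of degree `d ≥ D` costs at most `d ≤ D·C(d, D)` deletions, and `C(d, D)` counts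
`D`-sets of outputs all reading `u`.  As plain counting: `hdX D ω = Σ_u C(xdeg_ω(u), D)` (same for AND pairs, `hdA`), and
`Σ_ω hdX D ω ≤ N·C(m, D)·(2N·K₀)^D·|X|^{m−D}` (`sum_hdX_le`, cylinders `cylT`), the outputs at `x`-vertices of degree `≥ D` number at most
`D·hdX D ω` (`card_hdDel_le`).  Also the Markov-ready form of the overlap mass, `sum_card_ovl_le_card : Σ_ω #ovl ω ≤ 40K²·#Outcome`
(`m ≤ K·N`, `N ≥ 2`).  The alteration and the by-name supply are in `PstarExpandingBoundedDegSupply`.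
-/

set_option linter.dupNamespace false -- `Summit.PneNP.PneNP.…`: summit = sub-problem name (D-0017 single-conjunct layout)

open Finset Literature.Computability.Complexity
open Summit.PneNP.PneNP.Theorems.PstarSALevel (varSet)
open Summit.PneNP.PneNP.Theorems.PstarExpandingModel (DPair Outcome inst)
open Summit.PneNP.PneNP.Theorems.PstarUniformRepeats (card_DPair)
open Summit.PneNP.PneNP.Theorems.PstarOverlapCount (X xs as varSet_inst ovl sum_card_ovl_le card_filter_fst_mem_le
  card_filter_snd_mem_le pow_four_le_card_X card_Outcome_X)

namespace Summit.PneNP.PneNP.Theorems.PstarDegreeCount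

variable {N m : ℕ}

/-! ## Degrees in the typed model -/

/-- The outputs whose XOR pair contains `u`. -/
def xdegSet (ω : Outcome N m) (u : Fin N) : Finset (Fin m) := univ.filter fun j => u ∈ xs (ω j)

/-- The outputs whose AND pair contains `u`. -/
def adegSet (ω : Outcome N m) (u : Fin N) : Finset (Fin m) := univ.filter fun j => u ∈ as (ω j)

/-- The outputs reading the left-copy variable `castAdd u` are `xdegSet ω u`. -/
theorem filter_varSet_castAdd (ω : Outcome N m) (u : Fin N) :
    (univ.filter fun j : Fin m => Fin.castAdd N u ∈ varSet (inst ω) j) = xdegSet ω u := by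
  unfold xdegSet
  refine filter_congr (fun j _ => ?_)
  rw [varSet_inst, mem_union, mem_image, mem_image]
  constructor
  · rintro (⟨a, ha, he⟩ | ⟨c, -, he⟩)
    · rwa [← Fin.castAdd_injective _ _ he]
    · exact absurd he.symm (PstarExpandingModel.castAdd_ne_natAdd u c)
  · exact fun h => Or.inl ⟨u, h, rfl⟩

/-- The outputs reading the right-copy variable `natAdd u` are `adegSet ω u`. -/
theorem filter_varSet_natAdd (ω : Outcome N m) (u : Fin N) :
    (univ.filter fun j : Fin m => Fin.natAdd N u ∈ varSet (inst ω) j) = adegSet ω u := by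
  unfold adegSet
  refine filter_congr (fun j _ => ?_)
  rw [varSet_inst, mem_union, mem_image, mem_image]
  constructor
  · rintro (⟨a, -, he⟩ | ⟨c, hc, he⟩)
    · exact absurd he (PstarExpandingModel.castAdd_ne_natAdd a u)
    · rwa [← Fin.natAdd_injective _ _ he]
  · exact fun h => Or.inr ⟨u, h, rfl⟩

/-! ## High-degree witnesses and the deletion bound -/

/-- `hdX D ω = Σ_u C(xdeg(u), D)`: the number of pairs (vertex, `D`-set of outputs all reading it in their XOR pair). -/
def hdX (D : ℕ) (ω : Outcome N m) : ℕ := ∑ u : Fin N, ((xdegSet ω u).card).choose D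

/-- `hdA D ω = Σ_u C(adeg(u), D)`. -/
def hdA (D : ℕ) (ω : Outcome N m) : ℕ := ∑ u : Fin N, ((adegSet ω u).card).choose D

/-- `d ≤ D · C(d, D)` for `d ≥ D ≥ 1`. -/
theorem le_mul_choose {d D : ℕ} (hD : 1 ≤ D) (hd : D ≤ d) : d ≤ D * d.choose D := by
  obtain ⟨D', rfl⟩ : ∃ D', D = D' + 1 := ⟨D - 1, by omega⟩
  obtain ⟨d', rfl⟩ : ∃ d', d = d' + 1 := ⟨d - 1, by omega⟩
  have h := Nat.add_one_mul_choose_eq d' D'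
  have h1 : 1 ≤ d'.choose D' := Nat.choose_pos (by omega)
  nlinarith

/-- The outputs at `x`-vertices of degree `≥ D`. -/
def hdDelX (D : ℕ) (ω : Outcome N m) : Finset (Fin m) :=
  (univ.filter fun u : Fin N => D ≤ (xdegSet ω u).card).biUnion (xdegSet ω)

/-- The outputs at `a`-vertices of degree `≥ D`. -/
def hdDelA (D : ℕ) (ω : Outcome N m) : Finset (Fin m) :=
  (univ.filter fun u : Fin N => D ≤ (adegSet ω u).card).biUnion (adegSet ω)

/-- **Deletion bound**: `#hdDelX ≤ D · hdX` for `D ≥ 1`. -/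
theorem card_hdDelX_le {D : ℕ} (hD : 1 ≤ D) (ω : Outcome N m) : (hdDelX D ω).card ≤ D * hdX D ω := by
  unfold hdDelX hdX
  refine card_biUnion_le.trans ?_
  rw [mul_sum]
  calc ∑ u ∈ univ.filter (fun u : Fin N => D ≤ (xdegSet ω u).card), (xdegSet ω u).card
      ≤ ∑ u ∈ univ.filter (fun u : Fin N => D ≤ (xdegSet ω u).card), D * ((xdegSet ω u).card).choose D :=
        sum_le_sum fun u hu => le_mul_choose hD (mem_filter.1 hu).2
    _ ≤ ∑ u : Fin N, D * ((xdegSet ω u).card).choose D :=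
        sum_le_sum_of_subset_of_nonneg (filter_subset _ _) fun _ _ _ => Nat.zero_le _

/-- **Deletion bound**: `#hdDelA ≤ D · hdA` for `D ≥ 1`. -/
theorem card_hdDelA_le {D : ℕ} (hD : 1 ≤ D) (ω : Outcome N m) : (hdDelA D ω).card ≤ D * hdA D ω := by
  unfold hdDelA hdA
  refine card_biUnion_le.trans ?_
  rw [mul_sum]
  calc ∑ u ∈ univ.filter (fun u : Fin N => D ≤ (adegSet ω u).card), (adegSet ω u).card
      ≤ ∑ u ∈ univ.filter (fun u : Fin N => D ≤ (adegSet ω u).card), D * ((adegSet ω u).card).choose D :=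
        sum_le_sum fun u hu => le_mul_choose hD (mem_filter.1 hu).2
    _ ≤ ∑ u : Fin N, D * ((adegSet ω u).card).choose D :=
        sum_le_sum_of_subset_of_nonneg (filter_subset _ _) fun _ _ _ => Nat.zero_le _

/-- Outside the deleted outputs every `x`-vertex has degree `< D`. -/
theorem card_filter_xdeg_lt {D : ℕ} (ω : Outcome N m) (u : Fin N) {S : Finset (Fin m)} (hS : Disjoint S (hdDelX D ω)) :
    (S.filter fun j => u ∈ xs (ω j)).card < D ∨ (S.filter fun j => u ∈ xs (ω j)).card = 0 := by
  by_cases hu : D ≤ (xdegSet ω u).card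
  · right
    rw [card_eq_zero, filter_eq_empty_iff]
    intro j hj hju
    have : j ∈ hdDelX D ω := mem_biUnion.2 ⟨u, mem_filter.2 ⟨mem_univ _, hu⟩, mem_filter.2 ⟨mem_univ _, hju⟩⟩
    exact disjoint_left.1 hS hj this
  · left
    push Not at hu
    refine lt_of_le_of_lt (card_le_card fun j hj => ?_) hu
    rw [mem_filter] at hj
    exact mem_filter.2 ⟨mem_univ _, hj.2⟩

/-- Outside the deleted outputs every `a`-vertex has degree `< D`. -/
theorem card_filter_adeg_lt {D : ℕ} (ω : Outcome N m) (u : Fin N) {S : Finset (Fin m)} (hS : Disjoint S (hdDelA D ω)) :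
    (S.filter fun j => u ∈ as (ω j)).card < D ∨ (S.filter fun j => u ∈ as (ω j)).card = 0 := by
  by_cases hu : D ≤ (adegSet ω u).card
  · right
    rw [card_eq_zero, filter_eq_empty_iff]
    intro j hj hju
    have : j ∈ hdDelA D ω := mem_biUnion.2 ⟨u, mem_filter.2 ⟨mem_univ _, hu⟩, mem_filter.2 ⟨mem_univ _, hju⟩⟩
    exact disjoint_left.1 hS hj this
  · left
    push Not at hu
    refine lt_of_le_of_lt (card_le_card fun j hj => ?_) hu
    rw [mem_filter] at hj
    exact mem_filter.2 ⟨mem_univ _, hj.2⟩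

/-! ## Counting the witnesses -/

/-- Cylinder: outputs in `S` take values in `T`. -/
def cylT (S : Finset (Fin m)) (T : Finset (X N)) : Finset (Outcome N m) :=
  Fintype.piFinset fun j => if j ∈ S then T else univ

/-- Membership in `cylT`. -/
theorem mem_cylT {S : Finset (Fin m)} {T : Finset (X N)} {ω : Outcome N m} : ω ∈ cylT S T ↔ ∀ j ∈ S, ω j ∈ T := by
  simp only [cylT, Fintype.mem_piFinset]
  constructor
  · intro h j hj
    have := h j
    rwa [if_pos hj] at this
  · intro h j
    by_cases hj : j ∈ S
    · rw [if_pos hj]; exact h j hj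
    · rw [if_neg hj]; exact mem_univ _

/-- **Product count**: `#cylT S T = #T^{#S} · |X|^{m − #S}`. -/
theorem card_cylT (S : Finset (Fin m)) (T : Finset (X N)) :
    (cylT S T).card = T.card ^ S.card * (Fintype.card (X N)) ^ (m - S.card) := by
  classical
  unfold cylT
  rw [Fintype.card_piFinset]
  have h : ∀ j : Fin m, (if j ∈ S then T else (univ : Finset (X N))).card = if j ∈ S then T.card else Fintype.card (X N) := by
    intro j; split_ifs <;> simp
  simp_rw [h]
  rw [Finset.prod_ite, Finset.prod_const, Finset.prod_const]
  congr 2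
  · rw [Finset.filter_mem_eq_inter, Finset.univ_inter]
  · rw [Finset.filter_not, Finset.filter_mem_eq_inter, Finset.univ_inter, Finset.card_univ_sdiff, Fintype.card_fin]

/-- The output values whose XOR pair contains `u`: at most `2N · K₀`. -/
theorem card_XU_le (u : Fin N) : (univ.filter fun q : X N => u ∈ xs q).card ≤ 2 * N * Fintype.card (DPair N) := by
  have he : (univ.filter fun q : X N => u ∈ xs q) =
      (univ.filter fun p : DPair N => p.1.1 ∈ ({u} : Finset (Fin N)) ∨ p.1.2 ∈ ({u} : Finset (Fin N))) ×ˢ univ := by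
    ext q
    simp [xs, eq_comm]
  rw [he, card_product, card_univ, filter_or]
  have h1 := card_filter_fst_mem_le (N := N) {u}
  have h2 := card_filter_snd_mem_le (N := N) {u}
  rw [card_singleton, one_mul] at h1 h2
  have := card_union_le (univ.filter fun p : DPair N => p.1.1 ∈ ({u} : Finset (Fin N)))
    (univ.filter fun p : DPair N => p.1.2 ∈ ({u} : Finset (Fin N)))
  nlinarith

/-- The output values whose AND pair contains `u`: at most `2N · K₀`. -/
theorem card_AU_le (u : Fin N) : (univ.filter fun q : X N => u ∈ as q).card ≤ 2 * N * Fintype.card (DPair N) := by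
  have he : (univ.filter fun q : X N => u ∈ as q) =
      (univ : Finset (DPair N)) ×ˢ (univ.filter fun p : DPair N => p.1.1 ∈ ({u} : Finset (Fin N)) ∨ p.1.2 ∈ ({u} : Finset (Fin N))) := by
    ext q
    simp [as, eq_comm]
  rw [he, card_product, card_univ, filter_or]
  have h1 := card_filter_fst_mem_le (N := N) {u}
  have h2 := card_filter_snd_mem_le (N := N) {u}
  rw [card_singleton, one_mul] at h1 h2
  have := card_union_le (univ.filter fun p : DPair N => p.1.1 ∈ ({u} : Finset (Fin N)))
    (univ.filter fun p : DPair N => p.1.2 ∈ ({u} : Finset (Fin N)))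
  nlinarith

/-- `C(#s, D)` as a sum of indicators over `D`-subsets of the universe. -/
theorem choose_card_eq_sum (s : Finset (Fin m)) (D : ℕ) :
    (s.card).choose D = ∑ S ∈ (univ : Finset (Fin m)).powersetCard D, if S ⊆ s then 1 else 0 := by
  rw [← card_powersetCard, ← card_filter]
  congr 1
  ext S
  rw [mem_powersetCard, mem_filter, mem_powersetCard]
  constructor
  · rintro ⟨h1, h2⟩; exact ⟨⟨subset_univ _, h2⟩, h1⟩
  · rintro ⟨⟨-, h2⟩, h1⟩; exact ⟨h1, h2⟩

/-- **The witness mass**: `Σ_ω hdX D ω ≤ N · C(m, D) · (2N·K₀)^D · |X|^{m−D}`. -/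
theorem sum_hdX_le (D : ℕ) :
    ∑ ω : Outcome N m, hdX D ω ≤ N * (m.choose D * ((2 * N * Fintype.card (DPair N)) ^ D * Fintype.card (X N) ^ (m - D))) := by
  classical
  unfold hdX
  simp_rw [choose_card_eq_sum]
  rw [sum_comm]
  have hu : ∀ u : Fin N, (∑ ω : Outcome N m, ∑ S ∈ (univ : Finset (Fin m)).powersetCard D,
      if S ⊆ xdegSet ω u then 1 else 0) ≤ m.choose D * ((2 * N * Fintype.card (DPair N)) ^ D * Fintype.card (X N) ^ (m - D)) := by
    intro u
    rw [sum_comm]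
    have hS : ∀ S ∈ (univ : Finset (Fin m)).powersetCard D, (∑ ω : Outcome N m, if S ⊆ xdegSet ω u then 1 else 0) ≤
        (2 * N * Fintype.card (DPair N)) ^ D * Fintype.card (X N) ^ (m - D) := by
      intro S hS
      rw [mem_powersetCard] at hS
      rw [← card_filter]
      have he : (univ.filter fun ω : Outcome N m => S ⊆ xdegSet ω u) = cylT S (univ.filter fun q : X N => u ∈ xs q) := by
        ext ω
        rw [mem_filter, mem_cylT]
        simp only [mem_univ, true_and, xdegSet]
        constructor
        · intro h j hj
          exact mem_filter.2 ⟨mem_univ _, (mem_filter.1 (h hj)).2⟩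
        · intro h j hj
          exact mem_filter.2 ⟨mem_univ _, (mem_filter.1 (h j hj)).2⟩
      rw [he, card_cylT, hS.2]
      exact Nat.mul_le_mul_right _ (Nat.pow_le_pow_left (card_XU_le u) _)
    refine (sum_le_sum hS).trans ?_
    rw [sum_const, smul_eq_mul, card_powersetCard, card_univ, Fintype.card_fin]
  refine (sum_le_sum fun u _ => hu u).trans ?_
  rw [sum_const, smul_eq_mul, card_univ, Fintype.card_fin]

/-- **The witness mass (AND side)**: `Σ_ω hdA D ω ≤ N · C(m, D) · (2N·K₀)^D · |X|^{m−D}`. -/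
theorem sum_hdA_le (D : ℕ) :
    ∑ ω : Outcome N m, hdA D ω ≤ N * (m.choose D * ((2 * N * Fintype.card (DPair N)) ^ D * Fintype.card (X N) ^ (m - D))) := by
  classical
  unfold hdA
  simp_rw [choose_card_eq_sum]
  rw [sum_comm]
  have hu : ∀ u : Fin N, (∑ ω : Outcome N m, ∑ S ∈ (univ : Finset (Fin m)).powersetCard D,
      if S ⊆ adegSet ω u then 1 else 0) ≤ m.choose D * ((2 * N * Fintype.card (DPair N)) ^ D * Fintype.card (X N) ^ (m - D)) := by
    intro u
    rw [sum_comm]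
    have hS : ∀ S ∈ (univ : Finset (Fin m)).powersetCard D, (∑ ω : Outcome N m, if S ⊆ adegSet ω u then 1 else 0) ≤
        (2 * N * Fintype.card (DPair N)) ^ D * Fintype.card (X N) ^ (m - D) := by
      intro S hS
      rw [mem_powersetCard] at hS
      rw [← card_filter]
      have he : (univ.filter fun ω : Outcome N m => S ⊆ adegSet ω u) = cylT S (univ.filter fun q : X N => u ∈ as q) := by
        ext ω
        rw [mem_filter, mem_cylT]
        simp only [mem_univ, true_and, adegSet]
        constructor
        · intro h j hj
          exact mem_filter.2 ⟨mem_univ _, (mem_filter.1 (h hj)).2⟩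
        · intro h j hj
          exact mem_filter.2 ⟨mem_univ _, (mem_filter.1 (h j hj)).2⟩
      rw [he, card_cylT, hS.2]
      exact Nat.mul_le_mul_right _ (Nat.pow_le_pow_left (card_AU_le u) _)
    refine (sum_le_sum hS).trans ?_
    rw [sum_const, smul_eq_mul, card_powersetCard, card_univ, Fintype.card_fin]
  refine (sum_le_sum fun u _ => hu u).trans ?_
  rw [sum_const, smul_eq_mul, card_univ, Fintype.card_fin]

/-! ## The overlap mass in Markov-ready form -/

/-- `Σ_ω #ovl ω ≤ 40K² · #Outcome` for `m ≤ K·N`, `N ≥ 2`. -/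
theorem sum_card_ovl_le_card (K : ℕ) (hN : 2 ≤ N) (hm : m ≤ K * N) :
    ∑ ω : Outcome N m, (ovl ω).card ≤ 40 * K ^ 2 * Fintype.card (Outcome N m) := by
  classical
  set Xc := Fintype.card (X N) with hXc
  have h2 := sum_card_ovl_le (N := N) (m := m)
  have hX4 := pow_four_le_card_X hN
  rcases lt_or_ge m 2 with hm2 | hm2
  · rw [Nat.choose_eq_zero_of_lt hm2, zero_mul] at h2
    exact (Nat.le_zero.1 h2).le.trans (Nat.zero_le _)
  · have hΩ : Fintype.card (Outcome N m) = Xc * (Xc * Xc ^ (m - 2)) := by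
      rw [card_Outcome_X, ← hXc, ← pow_succ', ← pow_succ']; congr 1; omega
    rw [hΩ]
    set T := Xc * Xc ^ (m - 2) with hT
    have h4 : 2 * m.choose 2 ≤ K ^ 2 * N ^ 2 := by
      have : 2 * m.choose 2 ≤ m * m := by
        rw [Nat.choose_two_right]
        have := Nat.div_mul_le_self (m * (m - 1)) 2
        nlinarith [Nat.sub_le m 1]
      calc 2 * m.choose 2 ≤ m * m := this
        _ ≤ (K * N) * (K * N) := Nat.mul_le_mul hm hm
        _ = K ^ 2 * N ^ 2 := by ring
    have e1 : 2 * ∑ ω : Outcome N m, (ovl ω).card ≤ 2 * m.choose 2 * (20 * N ^ 2) * T := by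
      have := Nat.mul_le_mul_left 2 h2
      have e : 2 * (m.choose 2 * (20 * N ^ 2 * Xc * Xc ^ (m - 2))) = 2 * m.choose 2 * (20 * N ^ 2) * T := by rw [hT]; ring
      rw [e] at this
      exact this
    have e2 : 2 * m.choose 2 * (20 * N ^ 2) * T ≤ K ^ 2 * N ^ 2 * (20 * N ^ 2) * T :=
      Nat.mul_le_mul_right _ (Nat.mul_le_mul_right _ h4)
    have e3 : K ^ 2 * N ^ 2 * (20 * N ^ 2) * T = 20 * K ^ 2 * N ^ 4 * T := by ring
    have e4 : 20 * K ^ 2 * N ^ 4 * T ≤ 20 * K ^ 2 * (4 * Xc) * T := Nat.mul_le_mul_right _ (Nat.mul_le_mul_left _ hX4)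
    have e5 : 20 * K ^ 2 * (4 * Xc) * T = 2 * (40 * K ^ 2 * (Xc * T)) := by ring
    have : 2 * ∑ ω : Outcome N m, (ovl ω).card ≤ 2 * (40 * K ^ 2 * (Xc * T)) := by
      calc 2 * ∑ ω : Outcome N m, (ovl ω).card ≤ 2 * m.choose 2 * (20 * N ^ 2) * T := e1
        _ ≤ K ^ 2 * N ^ 2 * (20 * N ^ 2) * T := e2
        _ = 20 * K ^ 2 * N ^ 4 * T := e3
        _ ≤ 20 * K ^ 2 * (4 * Xc) * T := e4
        _ = 2 * (40 * K ^ 2 * (Xc * T)) := e5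
    omega

end Summit.PneNP.PneNP.Theorems.PstarDegreeCount
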